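import Summits.Ventures.LatticeQCDFlow.Exactness.Phi4FlowSquareIntegrableAcceptanceCeiling
import Summits.Ventures.LatticeQCDFlow.Exactness.Phi4FlowSquareIntegrableSticking
import HarnessLib

/-!
# The exact flow sampler and reweighting fail on the same observables: for EVERY flow, the series
# of a square-integrable `g` is summable iff its reweighting variance `Z⁻²∫ g² b w` is finite

HONEST FRAMING: exact (Metropolis-corrected) sampling algorithms for lattice gauge theory;
figures of merit are autocorrelation/cost numbers at stated couplings and volumes; no
continuum-physics claim.  (SCALAR calibration rung S0-A: not a gauge result.)

Venture `LatticeQCDFlow` (cell pub-lqcd), topic `Exactness`; FANOUT row 2 (`s0-phi4`, FLOW arm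
`K = imhOp μ w q̃`).  NEW WORK of the cell in the tree's vocabulary; printed counterpart NAMED,
nothing cited as a fact: Deligiannidis–Lee 2018 (Ann. Appl. Probab. 28) §3.1, Theorem "for the
IMH, `var(f, P) < ∞` iff `f ∈ L²₀(π)` and `w·f ∈ L²₀(μ)`" with its Lemma 4 (the two-level bound on
`1/ρ` when `π(w) = ∞`).  Here, on the square-integrable class and with NO hypothesis on the flow
beyond positivity and normalisation (in particular no finite second weight moment / positive Kish
fraction is assumed), both directions are assembled:
(⇐) `∫ g² b w < ∞` makes the column `G₂ = ∫ g² w/ρ` finite — under `W₂ < ∞` by the tree's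
`1/ρ ≤ (W₂ + bZ)/Z²` (`integrable_sq_mul_weight_div_acc_of_sq`), under `W₂ = ∞` by the two LEVEL
MASSES of this file: some level `C` has light target mass `m₁ = ∫ 1[b < C] w > 0` and heavy model
mass `m₂ = ∫ 1[C ≤ b] q̃ > 0`, and `1/ρ ≤ b/m₁ + 1/m₂` pointwise — and the acceptance-weighted
ceiling on `L²(w)` (`imhOp_tauInt_le_acceptanceCeiling_of_sq`) then PROVES summability;
(⇒) a summable series makes `g² w · r/(1 − r)` integrable (`imhOp_integrable_stickingOdds_of_summable`)
and `r/(1 − r) ≥ b/Z − 1` (`rejOdds_ge`) transfers this to `g² b w` — the step of the sibling file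
`FlowSamplerVsReweighting` (same session), re-derived here so that this file stands on built parents.
Since `∫ (g b)² q̃ dμ = ∫ g² b w dμ`, "`g² b w ∈ L¹`" is literally "`g·b ∈ L²(q̃ dμ)`", and
`Z⁻² ∫ g² b w = σ²_RW(g)` is the limiting `N·variance` of self-normalised reweighting of `N`
independent flow draws (row 4's `SelfNormalisedReweightingCLT`).

## What is proved

General space (`(X, μ)` s-finite; `w, q > 0` measurable integrable, `∫ q = 1`, `Z = ∫ w`, `b = w/q`,
`ρ(x) = 1 − λ(b(x))` the acceptance from `x`, `Π(C⁻) = massBelow μ w q C = ∫ 1[b < C] w`):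
* `massBelow_le_weight_mul_acc` — `C ≤ b(x) ⇒ Π(C⁻) ≤ b(x) ρ(x)`; `qMassGe_le_acc` —
  `b(x) < C ⇒ ∫ 1[C ≤ b] q ≤ ρ(x)`;
* `integrable_sq_mul_weight_div_acc_of_levels` — `Π(C⁻) > 0`, `∫ 1[C ≤ b] q > 0`, `∫ g² w < ∞`,
  `∫ g² b w < ∞` ⇒ `g² w/ρ ∈ L¹`; `exists_levels_of_not_integrable_weight` — `W₂ = ∞` supplies such
  a `C`; **`integrable_sq_mul_weight_div_acc_anyFlow`** — `g² w/ρ ∈ L¹` from `∫ g² w`, `∫ g² b w < ∞`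
  for EVERY flow;
* **`imhOp_summable_iff_integrable_sq_weight`** — `g` measurable, `∫ g² w < ∞`, `∫ g w = 0`,
  `∫ g² w > 0`: the normalised autocorrelation series of `g` under `imhOp μ w q` is summable **iff**
  `g² b w ∈ L¹(μ)`;
* `integral_sq_mul_weight_model` — `∫ (g b)² q = ∫ g² b w` (the `L²(q dμ)` reading);
* lattice φ⁴ (`Λ = Fin (n+1)`, `λ > 0`, real `J`, EVERY positive flow density `q̃`, `∫ q̃ = 1`,
  `b = e^{−S}/q̃`): **`phi4Flow_summable_iff_integrable_sq_weight_poly`** — for every `f ∈ PolyObs`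
  with `Var f > 0`: the series of `f` is summable iff `(f − ⟨f⟩)² b e^{−S} ∈ L¹`;
  **`phi4Flow_magnetisation_summable_iff_integrable_sq_weight`** — the magnetisation, no hypothesis.

Reading for S0-A (no numerics implied): an observable has a finite `τ_int·Var` under the exact
flow-MCMC chain exactly when it has a finite reweighting error bar — the two estimators built from
one trained flow succeed and fail on the same observables, whatever the network (and where both
succeed, `σ²_RW ≤ σ²_chain`, sibling file; under `W₂ < ∞` also
`σ²_chain ≤ (2/ā)(σ²_RW + Var/κ) − Var`).  NOT CLAIMED: Deligiannidis–Lee's `L¹ \ L²` half (an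
`f ∈ L¹₀ \ L²₀` has infinite variance); values for any network; HMC / local arms.
-/

namespace Summit.Ventures.LatticeQCDFlow.Exactness

open Real MeasureTheory Filter Set Topology
open Summit.Ventures.LatticeQCDFlow.Scoring

/-! ## §1 General space: the two level masses and `G₂ < ∞` for every flow -/

section General

variable {X : Type*} [MeasurableSpace X] {μ : Measure X} {w q : X → ℝ}

/-- `∫ (g b)² q dμ = ∫ g² b w dμ` (`b = w/q`, `q > 0`): "`g² b w ∈ L¹`" is "`g·b ∈ L²(q dμ)`". -/
theorem integral_sq_mul_weight_model (hq0 : ∀ t, 0 < q t) (g : X → ℝ) :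
    ∫ t, (g t * (w t / q t)) ^ 2 * q t ∂μ = ∫ t, g t ^ 2 * (w t / q t) * w t ∂μ :=
  integral_congr_ae (Eventually.of_forall fun t => by
    have hq := (hq0 t).ne'
    field_simp)

/-- **Acceptance from a HEAVY state is floored by the light target mass**: for `C ≤ b(x)`,
`Π(C⁻) = ∫ 1[b < C] w ≤ b(x) ρ(x)` (`Π(C⁻) ≤ Π(b(x)⁻) ≤ M(b(x)) = b(x)(1 − λ(b(x)))`). -/
theorem massBelow_le_weight_mul_acc (hw0 : ∀ t, 0 < w t) (hwm : Measurable w)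
    (hwi : Integrable w μ) (hq0 : ∀ t, 0 < q t) (hqm : Measurable q) (hqi : Integrable q μ)
    (hq1 : ∫ z, q z ∂μ = 1) {C : ℝ} {x : X} (hx : C ≤ w x / q x) :
    massBelow μ w q C ≤ (w x / q x) * (1 - rejCurve μ w q (w x / q x)) := by
  have hb : 0 < w x / q x := div_pos (hw0 x) (hq0 x)
  rw [mul_one_sub_rejCurve hw0 hwm hq0 hqm hqi hq1 hb]
  exact (massBelow_mono hw0 hwm hwi hqm hx).trans (clip_le hw0 hwm hwi hq0 hqm hb.le).2

/-- **Acceptance from a LIGHT state is floored by the heavy model mass**: for `b(x) < C`,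
`∫ 1[C ≤ b] q ≤ ρ(x)` (every proposal at least as heavy as `C` is accepted surely). -/
theorem qMassGe_le_acc (hw0 : ∀ t, 0 < w t) (hwm : Measurable w) (hwi : Integrable w μ)
    (hq0 : ∀ t, 0 < q t) (hqm : Measurable q) (hqi : Integrable q μ) (hq1 : ∫ z, q z ∂μ = 1)
    {C : ℝ} {x : X} (hx : w x / q x < C) :
    ∫ z, (if C ≤ w z / q z then q z else 0) ∂μ ≤ 1 - rejCurve μ w q (w x / q x) := by
  have hb : 0 < w x / q x := div_pos (hw0 x) (hq0 x)
  set v : ℝ := w x / q x with hv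
  have hM := mul_one_sub_rejCurve hw0 hwm hq0 hqm hqi hq1 hb
  obtain ⟨hci, hc0, -⟩ := integrable_clip hw0 hwm hwi hq0 hqm hb.le
  have hind_int : Integrable (fun z => (if C ≤ w z / q z then q z else 0 : ℝ)) μ := by
    refine Integrable.mono' hqi (Measurable.ite (measurableSet_le measurable_const (hwm.div hqm))
      hqm measurable_const).aestronglyMeasurable (Eventually.of_forall fun z => ?_)
    split_ifs with h
    · rw [Real.norm_eq_abs, abs_of_pos (hq0 z)]
    · rw [norm_zero]; exact (hq0 z).le
  -- `v · ∫ 1[C ≤ b] q ≤ ∫ min(w, v q) = v (1 − λ(v))`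
  have hle : v * ∫ z, (if C ≤ w z / q z then q z else 0) ∂μ ≤ ∫ z, min (w z) (v * q z) ∂μ := by
    rw [← integral_const_mul]
    refine integral_mono (hind_int.const_mul v) hci fun z => ?_
    show v * (if C ≤ w z / q z then q z else 0) ≤ min (w z) (v * q z)
    split_ifs with h
    · refine le_min ?_ le_rfl
      have hqz := hq0 z
      have : v ≤ w z / q z := le_of_lt (lt_of_lt_of_le hx h)
      calc v * q z ≤ (w z / q z) * q z := mul_le_mul_of_nonneg_right this hqz.le
        _ = w z := div_mul_cancel₀ _ hqz.ne'
    · rw [mul_zero]; exact hc0 z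
  rw [← hM] at hle
  exact le_of_mul_le_mul_left hle hb

variable [SFinite μ]

/-- **`g² w/ρ ∈ L¹` from two level masses, WITHOUT `W₂ < ∞`**: if some level `C` has light target
mass `m₁ = ∫ 1[b < C] w > 0` and heavy model mass `m₂ = ∫ 1[C ≤ b] q > 0`, then
`1/ρ ≤ b/m₁ + 1/m₂` pointwise and `∫ g² w < ∞`, `∫ g² b w < ∞` give `G₂ = ∫ g² w/ρ < ∞`
(Deligiannidis–Lee 2018, proof of Lemma 4, in the tree's vocabulary). -/
theorem integrable_sq_mul_weight_div_acc_of_levels (hw0 : ∀ t, 0 < w t) (hwm : Measurable w)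
    (hwi : Integrable w μ) (hq0 : ∀ t, 0 < q t) (hqm : Measurable q) (hqi : Integrable q μ)
    (hq1 : ∫ z, q z ∂μ = 1) {C : ℝ} (hm₁ : 0 < massBelow μ w q C)
    (hm₂ : 0 < ∫ z, (if C ≤ w z / q z then q z else 0) ∂μ) {g : X → ℝ} (hgm : Measurable g)
    (hg2 : Integrable (fun t => g t ^ 2 * w t) μ)
    (hgb : Integrable (fun t => g t ^ 2 * (w t / q t) * w t) μ) :
    Integrable (fun t => g t ^ 2 * w t / (1 - rejCurve μ w q (w t / q t))) μ := by
  set m₁ : ℝ := massBelow μ w q C with hm₁def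
  set m₂ : ℝ := ∫ z, (if C ≤ w z / q z then q z else 0) ∂μ with hm₂def
  have hρpos : ∀ t, 0 < 1 - rejCurve μ w q (w t / q t) := fun t =>
    (acc_mul_weight_le hw0 hwm hwi hq0 hqm hqi hq1 t).2.1
  have hdom : Integrable (fun t => 1 / m₁ * (g t ^ 2 * (w t / q t) * w t) + 1 / m₂ * (g t ^ 2 * w t)) μ :=
    (hgb.const_mul _).add (hg2.const_mul _)
  refine Integrable.mono' hdom (((hgm.pow_const 2).mul hwm).div (measurable_const.sub
    ((measurable_rejCurve hwm hqm).comp (hwm.div hqm)))).aestronglyMeasurable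
    (Eventually.of_forall fun t => ?_)
  have hgw0 : 0 ≤ g t ^ 2 * w t := mul_nonneg (sq_nonneg _) (hw0 t).le
  have hb0 : 0 < w t / q t := div_pos (hw0 t) (hq0 t)
  rw [Real.norm_eq_abs, abs_of_nonneg (div_nonneg hgw0 (hρpos t).le)]
  have hT1 : 0 ≤ 1 / m₁ * (g t ^ 2 * (w t / q t) * w t) :=
    mul_nonneg (div_pos one_pos hm₁).le (mul_nonneg (mul_nonneg (sq_nonneg _) hb0.le) (hw0 t).le)
  have hT2 : 0 ≤ 1 / m₂ * (g t ^ 2 * w t) := mul_nonneg (div_pos one_pos hm₂).le hgw0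
  rcases le_or_gt C (w t / q t) with hx | hx
  · -- heavy state: `1/ρ ≤ b/m₁`
    have h := massBelow_le_weight_mul_acc hw0 hwm hwi hq0 hqm hqi hq1 hx
    have hρ : m₁ / (w t / q t) ≤ 1 - rejCurve μ w q (w t / q t) := by
      rw [div_le_iff₀ hb0]; linarith
    calc g t ^ 2 * w t / (1 - rejCurve μ w q (w t / q t))
        ≤ g t ^ 2 * w t / (m₁ / (w t / q t)) :=
          div_le_div_of_nonneg_left hgw0 (div_pos hm₁ hb0) hρ
      _ = 1 / m₁ * (g t ^ 2 * (w t / q t) * w t) := by field_simp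
      _ ≤ _ := le_add_of_nonneg_right hT2
  · -- light state: `1/ρ ≤ 1/m₂`
    have hρ := qMassGe_le_acc hw0 hwm hwi hq0 hqm hqi hq1 hx
    calc g t ^ 2 * w t / (1 - rejCurve μ w q (w t / q t))
        ≤ g t ^ 2 * w t / m₂ := div_le_div_of_nonneg_left hgw0 hm₂ hρ
      _ = 1 / m₂ * (g t ^ 2 * w t) := by ring
      _ ≤ _ := le_add_of_nonneg_left hT1

omit [SFinite μ] in
/-- **An infinite second weight moment supplies the two levels**: if `b w ∉ L¹` (`W₂ = ∞`) then some
`C = N + 1` has `∫ 1[b < C] w > 0` and `∫ 1[C ≤ b] q > 0` (the latter for EVERY `C`: otherwise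
`b < C` a.e. and `W₂ ≤ C Z`; the former for large `C`: otherwise `b ≥ N + 1` a.e. for all `N`). -/
theorem exists_levels_of_not_integrable_weight (hw0 : ∀ t, 0 < w t) (hwm : Measurable w)
    (hwi : Integrable w μ) (hq0 : ∀ t, 0 < q t) (hqm : Measurable q) (hqi : Integrable q μ)
    (hq1 : ∫ z, q z ∂μ = 1) (hW : ¬ Integrable (fun x => w x / q x * w x) μ) :
    ∃ C : ℝ, 0 < massBelow μ w q C ∧ 0 < ∫ z, (if C ≤ w z / q z then q z else 0) ∂μ := by
  have hbm : Measurable fun z => w z / q z := hwm.div hqm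
  -- heavy model mass is positive at every level
  have hm₂ : ∀ C : ℝ, 0 < ∫ z, (if C ≤ w z / q z then q z else 0) ∂μ := by
    intro C
    have hmeas : Measurable fun z => (if C ≤ w z / q z then q z else 0 : ℝ) :=
      Measurable.ite (measurableSet_le measurable_const hbm) hqm measurable_const
    have hnn : ∀ z, 0 ≤ (if C ≤ w z / q z then q z else 0 : ℝ) := fun z => by
      split_ifs
      · exact (hq0 z).le
      · exact le_rfl
    have hint : Integrable (fun z => (if C ≤ w z / q z then q z else 0 : ℝ)) μ := by
      refine Integrable.mono' hqi hmeas.aestronglyMeasurable (Eventually.of_forall fun z => ?_)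
      rw [Real.norm_eq_abs, abs_of_nonneg (hnn z)]
      split_ifs
      · exact le_rfl
      · exact (hq0 z).le
    by_contra hle
    push Not at hle
    have h0 : ∫ z, (if C ≤ w z / q z then q z else 0) ∂μ = 0 :=
      le_antisymm hle (integral_nonneg hnn)
    rw [integral_eq_zero_iff_of_nonneg hnn hint] at h0
    -- a.e. `b < C`, hence `b w ≤ C w` a.e.: integrable — contradiction
    apply hW
    refine Integrable.mono' (hwi.const_mul |C|) (hbm.mul hwm).aestronglyMeasurable ?_
    filter_upwards [h0] with z hz
    have hlt : w z / q z < C := by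
      by_contra hge
      push Not at hge
      simp only [Pi.zero_apply, if_pos hge] at hz
      exact (hq0 z).ne' hz
    rw [Real.norm_eq_abs, abs_mul, abs_of_pos (div_pos (hw0 z) (hq0 z)), abs_of_pos (hw0 z)]
    exact mul_le_mul_of_nonneg_right (hlt.le.trans (le_abs_self C)) (hw0 z).le
  -- light target mass is positive at some integer level
  have hm₁ : ∃ N : ℕ, 0 < massBelow μ w q (N + 1) := by
    by_contra hall
    push Not at hall
    have hz : ∀ N : ℕ, ∀ᵐ z ∂μ, ((N : ℝ) + 1) ≤ w z / q z := by
      intro N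
      obtain ⟨hint, -⟩ := integrable_mass_integrands hw0 hwm hwi hqm ((N : ℝ) + 1)
      have hnn : ∀ z, 0 ≤ (if w z / q z < (N : ℝ) + 1 then w z else 0 : ℝ) := fun z => by
        split_ifs
        · exact (hw0 z).le
        · exact le_rfl
      have h0 : massBelow μ w q (N + 1) = 0 := le_antisymm (hall N) (integral_nonneg hnn)
      unfold massBelow at h0
      rw [integral_eq_zero_iff_of_nonneg hnn hint] at h0
      filter_upwards [h0] with z hz
      by_contra hlt
      push Not at hlt
      simp only [Pi.zero_apply, if_pos hlt] at hz
      exact (hw0 z).ne' hz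
    rw [← ae_all_iff] at hz
    have hfalse : ∀ᵐ z ∂μ, False := by
      filter_upwards [hz] with z hz
      obtain ⟨N, hN⟩ := exists_nat_gt (w z / q z)
      have := hz N
      linarith
    have hμ : μ = 0 := ae_eq_bot.1 (Filter.eventually_false_iff_eq_bot.1 hfalse)
    rw [hμ, integral_zero_measure] at hq1
    exact zero_ne_one hq1
  obtain ⟨N, hN⟩ := hm₁
  exact ⟨(N : ℝ) + 1, hN, hm₂ _⟩

/-- **`G₂ = ∫ g² w/ρ < ∞` for EVERY flow**, from `∫ g² w < ∞` and `∫ g² b w < ∞` alone: under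
`W₂ < ∞` by the tree's `1/ρ ≤ (W₂ + bZ)/Z²`, under `W₂ = ∞` by the two level masses. -/
theorem integrable_sq_mul_weight_div_acc_anyFlow (hw0 : ∀ t, 0 < w t) (hwm : Measurable w)
    (hwi : Integrable w μ) (hq0 : ∀ t, 0 < q t) (hqm : Measurable q) (hqi : Integrable q μ)
    (hq1 : ∫ z, q z ∂μ = 1) {g : X → ℝ} (hgm : Measurable g)
    (hg2 : Integrable (fun t => g t ^ 2 * w t) μ)
    (hgb : Integrable (fun t => g t ^ 2 * (w t / q t) * w t) μ) :
    Integrable (fun t => g t ^ 2 * w t / (1 - rejCurve μ w q (w t / q t))) μ := by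
  by_cases hW : Integrable (fun x => w x / q x * w x) μ
  · exact integrable_sq_mul_weight_div_acc_of_sq hw0 hwm hwi hq0 hqm hqi hq1 hW hgm hg2 hgb
  · obtain ⟨C, hm₁, hm₂⟩ := exists_levels_of_not_integrable_weight hw0 hwm hwi hq0 hqm hqi hq1 hW
    exact integrable_sq_mul_weight_div_acc_of_levels hw0 hwm hwi hq0 hqm hqi hq1 hm₁ hm₂ hgm hg2 hgb


/-! ## §2 Summable iff finite reweighting variance -/

/-- **SUMMABLE IFF FINITE REWEIGHTING VARIANCE, FOR EVERY FLOW.**  `w, q > 0` measurable integrable,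
`∫ q = 1`; `g` measurable with `∫ g² w < ∞`, centred, `∫ g² w > 0`.  The normalised autocorrelation
series of `g` along the exact flow sampler `imhOp μ w q` is summable iff `g² b w ∈ L¹(μ)` (iff
`σ²_RW(g) = Z⁻² ∫ g² b w < ∞`). -/
theorem imhOp_summable_iff_integrable_sq_weight (hw0 : ∀ t, 0 < w t) (hwm : Measurable w)
    (hwi : Integrable w μ) (hq0 : ∀ t, 0 < q t) (hqm : Measurable q) (hqi : Integrable q μ)
    (hq1 : ∫ z, q z ∂μ = 1) {g : X → ℝ}
    (hgm : Measurable g) (hg2 : Integrable (fun t => g t ^ 2 * w t) μ)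
    (hg0 : ∫ t, g t * w t ∂μ = 0) (hP : 0 < ∫ t, g t ^ 2 * w t ∂μ) :
    (Summable fun n => (∫ t, g t * ((imhOp μ w q)^[n + 1] g) t * w t ∂μ)
        / ∫ t, g t ^ 2 * w t ∂μ)
      ↔ Integrable (fun t => g t ^ 2 * (w t / q t) * w t) μ := by
  constructor
  · -- (⇒): the odds floor `r/(1 − r) ≥ b/Z − 1` transfers `g² w r/(1−r) ∈ L¹` to `g² b w`
    intro hs
    obtain ⟨-, -, hrm⟩ := rejection_bounds (μ := μ) hw0 hwm hq0 hqm hqi hq1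
    set r : X → ℝ := fun x => ∫ z, (1 - imhAcceptQ w q x z) * q z ∂μ with hr
    set Z : ℝ := ∫ z, w z ∂μ with hZdef
    have hZ : 0 < Z := integral_pos_of_pos hw0 hwi hq1
    obtain ⟨hoddsInt, -⟩ :=
      imhOp_integrable_stickingOdds_of_summable hw0 hwm hwi hq0 hqm hqi hq1 hgm hg2 hs
    have hgw0 : ∀ x, 0 ≤ g x ^ 2 * w x := fun x => mul_nonneg (sq_nonneg _) (hw0 x).le
    have hodds : ∀ x, w x / q x / Z - 1 ≤ r x / (1 - r x) := fun x => by
      have h := rejOdds_ge hw0 hwm hwi hq0 hqm hqi hq1 (div_pos (hw0 x) (hq0 x))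
      rw [← rejection_eq_rejCurve hw0 hq0 x] at h
      exact h
    have hdom : Integrable (fun x => Z * (g x ^ 2 * w x * (r x / (1 - r x)) + g x ^ 2 * w x)) μ :=
      (hoddsInt.add hg2).const_mul Z
    refine Integrable.mono' hdom (((hgm.pow_const 2).mul (hwm.div hqm)).mul hwm).aestronglyMeasurable
      (Eventually.of_forall fun x => ?_)
    have hL0 : 0 ≤ g x ^ 2 * (w x / q x) * w x :=
      mul_nonneg (mul_nonneg (sq_nonneg _) (div_pos (hw0 x) (hq0 x)).le) (hw0 x).le
    rw [Real.norm_eq_abs, abs_of_nonneg hL0]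
    have e : g x ^ 2 * (w x / q x) * w x = Z * (g x ^ 2 * w x * (w x / q x / Z - 1) + g x ^ 2 * w x) := by
      field_simp
      ring
    rw [e]
    refine mul_le_mul_of_nonneg_left ?_ hZ.le
    have h := mul_le_mul_of_nonneg_left (hodds x) (hgw0 x)
    linarith
  · -- (⇐): `G₂ < ∞` for every flow (§1), then the acceptance ceiling proves summability
    intro hgb
    have hG := integrable_sq_mul_weight_div_acc_anyFlow hw0 hwm hwi hq0 hqm hqi hq1 hgm hg2 hgb
    exact (imhOp_tauInt_le_acceptanceCeiling_of_sq hw0 hwm hwi hq0 hqm hqi hq1 hgm hg2 hg0 hP hG).1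

end General

/-! ## §3 Lattice φ⁴: every polynomial observable, the magnetisation -/

section Lattice

variable {n : ℕ}

/-- **SUMMABLE IFF FINITE REWEIGHTING VARIANCE, FOR EVERY POLYNOMIAL OBSERVABLE OF LATTICE φ⁴**
(`λ > 0`, real `J`, EVERY positive flow density `q̃` with `∫ q̃ = 1` — nothing else): for
`f ∈ PolyObs` with `Var f > 0` (unnormalised `∫ (f − ⟨f⟩)² e^{−S} > 0`), the series of `f` along
row 2's exact flow sampler is summable iff `(f − ⟨f⟩)² b e^{−S} ∈ L¹`, `b = e^{−S}/q̃`. -/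
theorem phi4Flow_summable_iff_integrable_sq_weight_poly {lam : ℝ} (hlam : 0 < lam)
    (J : Fin (n + 1) → Fin (n + 1) → ℝ) {q : (Fin (n + 1) → ℝ) → ℝ} (hq0 : ∀ φ, 0 < q φ)
    (hqm : Measurable q) (hqi : Integrable q) (hq1 : ∫ φ, q φ = 1)
    {f : (Fin (n + 1) → ℝ) → ℝ} (hf : PolyObs f)
    (hP : 0 < ∫ φ, (f φ - gibbsExpect J lam f) ^ 2 * gibbsWeight J lam φ) :
    (Summable fun k => (∫ φ, (f φ - gibbsExpect J lam f)
        * ((imhOpPhi4 J lam q)^[k + 1] (fun ψ => f ψ - gibbsExpect J lam f)) φ * gibbsWeight J lam φ)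
        / ∫ φ, (f φ - gibbsExpect J lam f) ^ 2 * gibbsWeight J lam φ)
      ↔ Integrable (fun φ => (f φ - gibbsExpect J lam f) ^ 2 * (gibbsWeight J lam φ / q φ)
          * gibbsWeight J lam φ) := by
  obtain ⟨hgm, hg2⟩ := polyObs_sq_integrable hlam J (polyObs_sub_const hf (gibbsExpect J lam f))
  have hg0 := integral_polyObs_sub_gibbsExpect hlam J hf
  rw [imhOpPhi4_eq_imhOp]
  exact imhOp_summable_iff_integrable_sq_weight (μ := volume) (fun φ => gibbsWeight_pos J lam φ)
    (continuous_gibbsWeight J lam).measurable (integrable_gibbsWeight hlam J) hq0 hqm hqi hq1 hgm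
    hg2 hg0 hP

/-- **THE MAGNETISATION** `M = Σ_x φ_x` (`Var M > 0` from the tree, `Phi4AbelFloors`): under ANY flow,
the series of `M` along the exact flow sampler is summable iff `M̃² b e^{−S} ∈ L¹` (`M̃ = M − ⟨M⟩`) —
no other hypothesis. -/
theorem phi4Flow_magnetisation_summable_iff_integrable_sq_weight {lam : ℝ} (hlam : 0 < lam)
    (J : Fin (n + 1) → Fin (n + 1) → ℝ) {q : (Fin (n + 1) → ℝ) → ℝ} (hq0 : ∀ φ, 0 < q φ)
    (hqm : Measurable q) (hqi : Integrable q) (hq1 : ∫ φ, q φ = 1) :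
    (Summable fun k => (∫ φ, ((∑ x, φ x) - gibbsExpect J lam (fun ψ => ∑ x, ψ x))
        * ((imhOpPhi4 J lam q)^[k + 1]
            (fun ψ => (∑ x, ψ x) - gibbsExpect J lam (fun ψ => ∑ x, ψ x))) φ * gibbsWeight J lam φ)
        / ∫ φ, ((∑ x, φ x) - gibbsExpect J lam (fun ψ => ∑ x, ψ x)) ^ 2 * gibbsWeight J lam φ)
      ↔ Integrable (fun φ : Fin (n + 1) → ℝ =>
          ((∑ x, φ x) - gibbsExpect J lam (fun ψ => ∑ x, ψ x)) ^ 2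
            * (gibbsWeight J lam φ / q φ) * gibbsWeight J lam φ) :=
  phi4Flow_summable_iff_integrable_sq_weight_poly hlam J hq0 hqm hqi hq1 polyObs_magnetisation
    (integral_magnetisation_sub_sq_mul_gibbsWeight_pos hlam J _)

end Lattice

end Summit.Ventures.LatticeQCDFlow.Exactness
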